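import Literature.NumberTheory.Sieve.BombieriFriedlanderIwaniecPartition
import Literature.NumberTheory.Sieve.ShiuBrunTitchmarsh
import HarnessLib

/-!
# Bombieri–Friedlander–Iwaniec 1986, §15: the trivially bounded parts of the sieved, boxed sum

Topic `Literature/NumberTheory/Sieve`, companion to
`Literature.NumberTheory.Sieve.BombieriFriedlanderIwaniecPartition` (the decomposition
`sievedDisc (hbPiece U j) = ∑_κ (c_κ · sievedDisc (PMain κ) + sievedDisc (PErr κ))` of a sieved
Heath-Brown piece into box-tuples, BFI §15 pp. 245–246).  Everything here is PROVED (from the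
named facts `Literature.NumberTheory.Sieve.BombieriFriedlanderIwaniecLemma3`, BFI Lemma 3 p. 211,
and `Literature.NumberTheory.Sieve.Shiu1980BrunTitchmarsh`, Shiu 1980 Thm 1).  It disposes of the
two parts of that decomposition which the source treats as trivially admissible once
`Δ = ℒ^{−A₁}` with `A₁` large (p. 245: "the problem is reduced to estimating the sums
`𝓔(M₁,…,M_j | N₁,…,N_j)`" — i.e. only the interior main products are fed to Theorems 1, 2, 5*):

* `Literature.NumberTheory.Sieve.BFI.sum_abs_sievedDisc_le` — the generic estimate
  `∑_{q ≤ D, (q,a)=1} |sievedDisc F q a z x| ≤ ∑_{x<n≤2x} |F(n)| τ(n − a) + (∑_{q≤D} φ(q)⁻¹) ∑_{x<n≤2x} |F(n)|`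
  (count the moduli `q ∣ n − a`), and its pointwise form `abs_sievedDisc_le`.
* `Literature.NumberTheory.Sieve.BFI.sum_abs_sievedDisc_prodErr_le` — the ERROR PRODUCTS (the
  factor `log n₁` replaced by a constant on its box): summed over all tuples `κ` and all moduli
  `q ≤ D ≤ x` they contribute `≤ C Δ x (log x)^B` (`∑_κ |PErr κ| ≤ Δ τ^{14}` pointwise and
  Lemma 3 at `k = 1`).
* `Literature.NumberTheory.Sieve.BFI.sum_abs_sievedDisc_prodMain_not_interior_le` — the
  NON-INTERIOR main products (tuples of boxes not inside `(x, 2x]`): they live on the two slivers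
  `(x, x + 28Δx]`, `(2x − 28Δx, 2x]` and contribute `≤ C Δ x (log x)^B` for `D ≤ x^{4/7}`,
  `x^{−1/5} ≤ Δ ≤ 1/28` (Shiu's theorem for `τ^{14}` in progressions `q < (Δ x)^{3/4}`).

## References

* E. Bombieri, J. B. Friedlander, H. Iwaniec, *Primes in arithmetic progressions to large moduli*,
  Acta Math. 156 (1986), 203–251, §2 Lemma 3 p. 211, §15 pp. 244–246.
  [BombieriFriedlanderIwaniecActa1986]
* P. Shiu, *A Brun–Titchmarsh theorem for multiplicative functions*, J. reine angew. Math. 313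
  (1980), 161–170, Theorem 1. [Shiu1980]
-/

open Finset Real
open scoped ArithmeticFunction.sigma

namespace Literature.NumberTheory.Sieve

namespace BFI

/-! ### Counting moduli: the generic bound -/

/-- For integers `n > a`, the number of moduli `1 ≤ q ≤ Dn` with `n ≡ a (mod q)` is at most
`τ(n − a)` (each such `q` divides the positive integer `n − a`). [folklore] -/
theorem card_filter_natCast_eq_le_sigma {a : ℤ} {n : ℕ} (hn : a < n) (Dn : ℕ) :
    (#((Icc 1 Dn).filter (fun q : ℕ => (n : ZMod q) = (a : ZMod q))) : ℝ) ≤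
      (σ 0 (Int.toNat ((n : ℤ) - a)) : ℝ) := by
  set m : ℕ := Int.toNat ((n : ℤ) - a) with hm
  have hm0 : 0 < (n : ℤ) - a := by omega
  have hmz : (m : ℤ) = (n : ℤ) - a := by rw [hm, Int.toNat_of_nonneg hm0.le]
  have hm1 : m ≠ 0 := by
    intro h; rw [h] at hmz; simp at hmz; omega
  rw [ArithmeticFunction.sigma_zero_apply]
  have hsub : (Icc 1 Dn).filter (fun q : ℕ => (n : ZMod q) = (a : ZMod q)) ⊆ m.divisors := by
    intro q hq
    rw [Finset.mem_filter, Finset.mem_Icc] at hq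
    rw [Nat.mem_divisors]
    refine ⟨?_, hm1⟩
    have h1 : ((((n : ℤ) - a : ℤ)) : ZMod q) = 0 := by
      push_cast; rw [hq.2, sub_self]
    rw [ZMod.intCast_zmod_eq_zero_iff_dvd, ← hmz] at h1
    exact_mod_cast h1
  exact_mod_cast Finset.card_le_card hsub

/-- **Generic bound for sifted dyadic discrepancies summed over the moduli.**  For any `F` and
`x ≥ |a|`:
`∑_{q ≤ Dn, (q,a)=1} |sievedDisc F q a z x| ≤ ∑_{x<n≤2x} |F(n)| τ(n − a) + (∑_{q ≤ Dn} φ(q)⁻¹) ∑_{x<n≤2x} |F(n)|`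
(drop the sieve conditions, interchange the summations and count the `q ∣ n − a`).  This is the
mechanism of all "trivial" estimates in BFI §15. [folklore] -/
theorem sum_abs_sievedDisc_le (F : ℕ → ℝ) {a : ℤ} {x : ℝ} (hx : |(a : ℝ)| ≤ x) (z : ℝ) (Dn : ℕ) :
    ∑ q ∈ (Icc 1 Dn).filter (fun q : ℕ => IsCoprime (q : ℤ) a), |sievedDisc F q a z x| ≤
      (∑ n ∈ Ioc ⌊x⌋₊ ⌊2 * x⌋₊, |F n| * (σ 0 (Int.toNat ((n : ℤ) - a)) : ℝ)) +
        (∑ q ∈ Icc 1 Dn, ((Nat.totient q : ℝ))⁻¹) * ∑ n ∈ Ioc ⌊x⌋₊ ⌊2 * x⌋₊, |F n| := by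
  have hq1 : ∀ q : ℕ, |sievedDisc F q a z x| ≤
      (∑ n ∈ Ioc ⌊x⌋₊ ⌊2 * x⌋₊, if (n : ZMod q) = (a : ZMod q) then |F n| else 0) +
        ((Nat.totient q : ℝ))⁻¹ * ∑ n ∈ Ioc ⌊x⌋₊ ⌊2 * x⌋₊, |F n| := by
    intro q
    unfold sievedDisc
    refine (abs_sub _ _).trans (add_le_add ?_ ?_)
    · refine (Finset.abs_sum_le_sum_abs _ _).trans (Finset.sum_le_sum fun n _ => ?_)
      by_cases h : (n : ZMod q) = (a : ZMod q)
      · rw [if_pos h]; split_ifs <;> simp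
      · rw [if_neg h, if_neg (fun h' => h h'.2), abs_zero]
    · rw [abs_div, Nat.abs_cast, div_eq_inv_mul]
      refine mul_le_mul_of_nonneg_left ?_ (inv_nonneg.2 (Nat.cast_nonneg _))
      refine (Finset.abs_sum_le_sum_abs _ _).trans (Finset.sum_le_sum fun n _ => ?_)
      split_ifs <;> simp
  refine (Finset.sum_le_sum fun q _ => hq1 q).trans ?_
  rw [Finset.sum_add_distrib]
  refine add_le_add ?_ ?_
  · rw [Finset.sum_comm]
    refine Finset.sum_le_sum fun n hn => ?_
    rw [Finset.mem_Ioc] at hn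
    have hxn : x < n := Nat.lt_of_floor_lt hn.1
    have han : a < (n : ℤ) := by
      have : (a : ℝ) < n := (le_abs_self (a : ℝ)).trans hx |>.trans_lt hxn
      exact_mod_cast this
    rw [← Finset.sum_filter, Finset.sum_const, nsmul_eq_mul, mul_comm]
    refine mul_le_mul_of_nonneg_left ?_ (abs_nonneg _)
    refine le_trans ?_ (card_filter_natCast_eq_le_sigma han Dn)
    exact_mod_cast Finset.card_le_card (Finset.filter_subset_filter _ (Finset.filter_subset _ _))
  · rw [Finset.sum_mul]
    refine Finset.sum_le_sum_of_subset_of_nonneg (Finset.filter_subset _ _) fun q _ _ => ?_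
    exact mul_nonneg (inv_nonneg.2 (Nat.cast_nonneg _)) (Finset.sum_nonneg fun _ _ => abs_nonneg _)

/-- The generic bound summed over a finite family `F i` with a pointwise majorant
`∑_i |F i n| ≤ G n` on `(x, 2x]`: `∑_{q} ∑_i |sievedDisc (F i) q| ≤ ∑_n G(n) τ(n−a) + Φ ∑_n G(n)`.
[folklore] -/
theorem sum_sum_abs_sievedDisc_le {ι : Type*} (s : Finset ι) (F : ι → ℕ → ℝ) {G : ℕ → ℝ}
    {a : ℤ} {x : ℝ} (hx : |(a : ℝ)| ≤ x)
    (hG : ∀ n ∈ Ioc ⌊x⌋₊ ⌊2 * x⌋₊, ∑ i ∈ s, |F i n| ≤ G n) (z : ℝ) (Dn : ℕ) :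
    ∑ q ∈ (Icc 1 Dn).filter (fun q : ℕ => IsCoprime (q : ℤ) a), ∑ i ∈ s, |sievedDisc (F i) q a z x| ≤
      (∑ n ∈ Ioc ⌊x⌋₊ ⌊2 * x⌋₊, G n * (σ 0 (Int.toNat ((n : ℤ) - a)) : ℝ)) +
        (∑ q ∈ Icc 1 Dn, ((Nat.totient q : ℝ))⁻¹) * ∑ n ∈ Ioc ⌊x⌋₊ ⌊2 * x⌋₊, G n := by
  rw [Finset.sum_comm]
  refine (Finset.sum_le_sum fun i _ => sum_abs_sievedDisc_le (F i) hx z Dn).trans ?_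
  rw [Finset.sum_add_distrib, ← Finset.mul_sum, Finset.sum_comm,
    Finset.sum_comm (s := s)]
  refine add_le_add (Finset.sum_le_sum fun n hn => ?_)
    (mul_le_mul_of_nonneg_left (Finset.sum_le_sum fun n hn => ?_)
      (Finset.sum_nonneg fun _ _ => inv_nonneg.2 (Nat.cast_nonneg _)))
  · rw [← Finset.sum_mul]
    exact mul_le_mul_of_nonneg_right (hG n hn) (Nat.cast_nonneg _)
  · exact hG n hn


/-! ### Two elementary inequalities for `(1+Δ)^m` -/

/-- `(1+Δ)^m ≤ 1 + 2mΔ` for `Δ ≥ 0`, `mΔ ≤ 1` (`(1+Δ)^m ≤ e^{mΔ} ≤ 1 + mΔ + (mΔ)²`). [folklore] -/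
theorem one_add_pow_le_one_add {Δ : ℝ} (hΔ : 0 ≤ Δ) {m : ℕ} (hm : (m : ℝ) * Δ ≤ 1) :
    (1 + Δ) ^ m ≤ 1 + 2 * (m * Δ) := by
  have h1 : (1 + Δ) ^ m ≤ Real.exp (m * Δ) := by
    calc (1 + Δ) ^ m ≤ Real.exp Δ ^ m :=
          pow_le_pow_left₀ (by linarith) (by linarith [Real.add_one_le_exp Δ]) m
      _ = Real.exp (m * Δ) := by rw [← Real.exp_nat_mul]
  have h2 : |Real.exp (m * Δ) - 1 - m * Δ| ≤ (m * Δ) ^ 2 :=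
    Real.abs_exp_sub_one_sub_id_le (by rw [abs_of_nonneg (by positivity)]; exact hm)
  have h3 : (m * Δ) ^ 2 ≤ m * Δ := by
    have : 0 ≤ (m : ℝ) * Δ := by positivity
    nlinarith
  have h4 := (abs_le.1 h2).2
  linarith

/-- `(1 − mΔ)(1+Δ)^m ≤ 1` for `Δ ≥ 0` (`(1 − t) e^t ≤ 1`), in the form `T − mΔT ≤ T/(1+Δ)^m` for
`T ≥ 0`. [folklore] -/
theorem sub_mul_le_div_one_add_pow {Δ T : ℝ} (hΔ : 0 ≤ Δ) (hT : 0 ≤ T) (m : ℕ) :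
    T - m * Δ * T ≤ T / (1 + Δ) ^ m := by
  have hpos : 0 < (1 + Δ) ^ m := by positivity
  rw [le_div_iff₀ hpos]
  have h1 : (1 + Δ) ^ m ≤ Real.exp (m * Δ) := by
    calc (1 + Δ) ^ m ≤ Real.exp Δ ^ m :=
          pow_le_pow_left₀ (by linarith) (by linarith [Real.add_one_le_exp Δ]) m
      _ = Real.exp (m * Δ) := by rw [← Real.exp_nat_mul]
  have h2 : 1 - m * Δ ≤ Real.exp (-(m * Δ)) := Real.one_sub_le_exp_neg _
  rcases le_or_gt (1 - m * Δ) 0 with h | h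
  · calc (T - m * Δ * T) * (1 + Δ) ^ m = T * (1 - m * Δ) * (1 + Δ) ^ m := by ring
      _ ≤ 0 := mul_nonpos_of_nonpos_of_nonneg (mul_nonpos_of_nonneg_of_nonpos hT h) hpos.le
      _ ≤ T := hT
  · calc (T - m * Δ * T) * (1 + Δ) ^ m = T * ((1 - m * Δ) * (1 + Δ) ^ m) := by ring
      _ ≤ T * (Real.exp (-(m * Δ)) * Real.exp (m * Δ)) :=
          mul_le_mul_of_nonneg_left (mul_le_mul h2 h1 hpos.le (Real.exp_pos _).le) hT
      _ = T := by rw [← Real.exp_add, neg_add_cancel, Real.exp_zero, mul_one]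

/-! ### The error products -/

/-- **The divisor-moment bound behind the trivial estimates** (from BFI Lemma 3 at `k = 1` and the
elementary moments of `τ`): for `a ≠ 0` there are `B, C ≥ 0`, `x₀` such that for `x ≥ x₀` and
`Dn ≤ x`,
`∑_{x<n≤2x} τ(n)^{14} τ(n−a) + (∑_{q≤Dn} 1/φ(q)) ∑_{x<n≤2x} τ(n)^{14} ≤ C x (log x)^B`.
[cite: BombieriFriedlanderIwaniecActa1986, §2 Lemma 3 p. 211] -/
theorem tau14_moments_le (hL3 : BombieriFriedlanderIwaniecLemma3) {a : ℤ} (ha : a ≠ 0) :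
    ∃ B C x₀ : ℝ, 0 ≤ B ∧ 0 ≤ C ∧ ∀ x : ℝ, x₀ ≤ x → ∀ Dn : ℕ, (Dn : ℝ) ≤ x →
      (∑ n ∈ Ioc ⌊x⌋₊ ⌊2 * x⌋₊, (σ 0 n : ℝ) ^ 14 * (σ 0 (Int.toNat ((n : ℤ) - a)) : ℝ)) +
        (∑ q ∈ Icc 1 Dn, ((Nat.totient q : ℝ))⁻¹) * ∑ n ∈ Ioc ⌊x⌋₊ ⌊2 * x⌋₊, (σ 0 n : ℝ) ^ 14 ≤
      C * x * Real.log x ^ B := by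
  obtain ⟨B, C, x₁, hL⟩ := hL3 a ha ((14 : ℕ) : ℝ) (by positivity) (1 / 2) (by norm_num)
  obtain ⟨C₁, hC₁, h₁⟩ := exists_sum_sigma_zero_pow_le_real 14
  obtain ⟨C₂, hC₂, h₂⟩ := exists_sum_sigma_zero_pow_div_totient_le_real 0
  -- keep the large numeral `E` opaque (no evaluation of `2 ^ (E)`)
  obtain ⟨E, hE⟩ : ∃ E : ℕ, E = 2 ^ (14 + 1) := ⟨_, rfl⟩
  rw [← hE] at h₁
  set B' : ℝ := max B 0 with hB'
  refine ⟨B' + ((E + 4 : ℕ) : ℝ), 2 * |C| * 2 ^ B' + 2 * C₁ * C₂ * 2 ^ E, max x₁ (max (|(a : ℝ)|) 4),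
    by positivity, by positivity, fun x hx Dn hDn => ?_⟩
  have hx₁ : x₁ ≤ x := le_trans (le_max_left _ _) hx
  have hxa : |(a : ℝ)| ≤ x := le_trans ((le_max_left _ _).trans (le_max_right _ _)) hx
  have hx4 : (4 : ℝ) ≤ x := le_trans ((le_max_right _ _).trans (le_max_right _ _)) hx
  have hx0 : 0 < x := by linarith
  have hL1 : 1 ≤ Real.log x := by
    rw [Real.le_log_iff_exp_le hx0]
    exact le_trans (by have := Real.exp_one_lt_d9; norm_num at this ⊢; linarith) hx4
  have hL0 : 0 < Real.log x := by linarith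
  have hlog2x : Real.log (2 * x) ≤ 2 * Real.log x := by
    rw [Real.log_mul (by norm_num) hx0.ne']
    have : Real.log 2 ≤ Real.log x := Real.log_le_log (by norm_num) (by linarith)
    linarith
  have hlog2x1 : 1 ≤ Real.log (2 * x) := hL1.trans (Real.log_le_log hx0 (by linarith))
  -- (1) Lemma 3 at `k = 1`
  have hA : ∑ n ∈ Ioc ⌊x⌋₊ ⌊2 * x⌋₊, (σ 0 n : ℝ) ^ 14 * (σ 0 (Int.toNat ((n : ℤ) - a)) : ℝ) ≤
      |C| * (2 * x) * (2 * Real.log x) ^ B' := by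
    have h := hL (2 * x) (by linarith) 1 le_rfl
      (by rw [Nat.cast_one]; exact Real.one_le_rpow (by linarith) (by norm_num)) (0 : ZMod 1)
    have hσ1 : ((σ 0 1 : ℕ) : ℝ) = 1 := by simp
    simp only [Real.rpow_natCast, Nat.cast_one, div_one, hσ1, one_mul] at h
    calc ∑ n ∈ Ioc ⌊x⌋₊ ⌊2 * x⌋₊, (σ 0 n : ℝ) ^ 14 * (σ 0 (Int.toNat ((n : ℤ) - a)) : ℝ)
        ≤ ∑ n ∈ Ioc ⌊x⌋₊ ⌊2 * x⌋₊,
            (σ 0 n : ℝ) ^ 14 * (σ 0 (Int.toNat ((n : ℤ) - a)) : ℝ) ^ 14 := by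
          refine Finset.sum_le_sum fun n hn => ?_
          rw [Finset.mem_Ioc] at hn
          have hxn : x < n := Nat.lt_of_floor_lt hn.1
          have han : |a| < (n : ℤ) := by
            have : |(a : ℝ)| < n := hxa.trans_lt hxn
            rw [← Int.cast_abs] at this
            exact_mod_cast this
          have h1 : (1 : ℝ) ≤ (σ 0 (Int.toNat ((n : ℤ) - a)) : ℝ) := by
            have := BombieriFriedlanderIwaniecLemma3.one_le_toNat_sub han
            exact_mod_cast one_le_sigma_zero (by omega)
          refine mul_le_mul_of_nonneg_left ?_ (by positivity)
          exact le_self_pow₀ h1 (by norm_num)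
      _ ≤ ∑ m ∈ (Icc 1 ⌊2 * x⌋₊).filter (fun m : ℕ => |a| < (m : ℤ) ∧ (m : ZMod 1) = 0),
            (σ 0 m : ℝ) ^ 14 * (σ 0 (Int.toNat ((m : ℤ) - a)) : ℝ) ^ 14 := by
          refine Finset.sum_le_sum_of_subset_of_nonneg (fun n hn => ?_) fun _ _ _ => by positivity
          rw [Finset.mem_Ioc] at hn
          rw [Finset.mem_filter, Finset.mem_Icc]
          have hxn : x < n := Nat.lt_of_floor_lt hn.1
          have han : |a| < (n : ℤ) := by
            have : |(a : ℝ)| < n := hxa.trans_lt hxn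
            rw [← Int.cast_abs] at this
            exact_mod_cast this
          exact ⟨⟨by omega, hn.2⟩, han, Subsingleton.elim _ _⟩
      _ ≤ C * (2 * x) * Real.log (2 * x) ^ B := by
          convert h using 2
      _ ≤ |C| * (2 * x) * (2 * Real.log x) ^ B' := by
          have h3 : Real.log (2 * x) ^ B ≤ (2 * Real.log x) ^ B' :=
            (Real.rpow_le_rpow_of_exponent_le hlog2x1 (le_max_left _ _)).trans
              (Real.rpow_le_rpow (by linarith) hlog2x (le_max_right _ _))
          calc C * (2 * x) * Real.log (2 * x) ^ B ≤ |C| * (2 * x) * Real.log (2 * x) ^ B :=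
                mul_le_mul_of_nonneg_right (mul_le_mul_of_nonneg_right (le_abs_self C) (by linarith))
                  (Real.rpow_nonneg (by linarith) _)
            _ ≤ |C| * (2 * x) * (2 * Real.log x) ^ B' :=
                mul_le_mul_of_nonneg_left h3 (by positivity)
  -- (2) the plain moment and the totient sum
  have hB2 : ∑ n ∈ Ioc ⌊x⌋₊ ⌊2 * x⌋₊, (σ 0 n : ℝ) ^ 14 ≤ C₁ * (2 * x) * (2 * Real.log x) ^ (E) := by
    calc ∑ n ∈ Ioc ⌊x⌋₊ ⌊2 * x⌋₊, (σ 0 n : ℝ) ^ 14 ≤ ∑ n ∈ Icc 1 ⌊2 * x⌋₊, (σ 0 n : ℝ) ^ 14 :=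
          Finset.sum_le_sum_of_subset_of_nonneg (fun n hn => by
            rw [Finset.mem_Ioc] at hn; rw [Finset.mem_Icc]; omega) fun _ _ _ => by positivity
      _ ≤ C₁ * (2 * x) * Real.log (2 * x) ^ (E) := h₁ (2 * x) (by linarith)
      _ ≤ C₁ * (2 * x) * (2 * Real.log x) ^ (E) := by
          refine mul_le_mul_of_nonneg_left ?_ (by positivity)
          exact pow_le_pow_left₀ (by linarith) hlog2x _
  have hΦ : ∑ q ∈ Icc 1 Dn, ((Nat.totient q : ℝ))⁻¹ ≤ C₂ * Real.log x ^ (2 ^ 2) := by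
    have h := h₂ x (by linarith)
    simp only [pow_zero, one_div] at h
    refine le_trans (Finset.sum_le_sum_of_subset_of_nonneg (Finset.Icc_subset_Icc le_rfl
      (Nat.le_floor hDn)) fun _ _ _ => inv_nonneg.2 (Nat.cast_nonneg _)) h
  have hΦ0 : 0 ≤ ∑ q ∈ Icc 1 Dn, ((Nat.totient q : ℝ))⁻¹ :=
    Finset.sum_nonneg fun _ _ => inv_nonneg.2 (Nat.cast_nonneg _)
  -- (3) assemble
  have hpow1 : (2 * Real.log x) ^ B' = 2 ^ B' * Real.log x ^ B' := Real.mul_rpow (by norm_num) hL0.le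
  have hLB : Real.log x ^ B' ≤ Real.log x ^ (B' + ((E + 4 : ℕ) : ℝ)) :=
    Real.rpow_le_rpow_of_exponent_le hL1 (le_add_of_nonneg_right (by positivity))
  have hL2 : Real.log x ^ (2 ^ 2) * Real.log x ^ (E) ≤ Real.log x ^ (B' + ((E + 4 : ℕ) : ℝ)) := by
    rw [← pow_add, ← Real.rpow_natCast]
    refine Real.rpow_le_rpow_of_exponent_le hL1 ?_
    have : (0 : ℝ) ≤ B' := le_max_right _ _
    push_cast
    linarith
  calc _ ≤ |C| * (2 * x) * (2 * Real.log x) ^ B' +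
        (C₂ * Real.log x ^ (2 ^ 2)) * (C₁ * (2 * x) * (2 * Real.log x) ^ (E)) :=
        add_le_add hA (mul_le_mul hΦ hB2 (Finset.sum_nonneg fun _ _ => by positivity) (by positivity))
    _ = (2 * |C| * 2 ^ B') * x * Real.log x ^ B' +
        (2 * C₁ * C₂ * 2 ^ (E)) * x * (Real.log x ^ (2 ^ 2) * Real.log x ^ (E)) := by
        rw [hpow1, mul_pow]; ring
    _ ≤ (2 * |C| * 2 ^ B') * x * Real.log x ^ (B' + ((E + 4 : ℕ) : ℝ)) +
        (2 * C₁ * C₂ * 2 ^ (E)) * x * Real.log x ^ (B' + ((E + 4 : ℕ) : ℝ)) :=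
        add_le_add (mul_le_mul_of_nonneg_left hLB (by positivity))
          (mul_le_mul_of_nonneg_left hL2 (by positivity))
    _ = _ := by ring


/-- **The error products are negligible** (BFI §15, p. 245–246: replacing `log n₁` by a constant on
each box costs a factor `Δ = ℒ^{−A₁}`): for `a ≠ 0` there are `B, C ≥ 0`, `x₀` such that for `x ≥ x₀`,
`1 ≤ j ≤ 7`, `0 < Δ ≤ 1`, all `z, U, K` and `Dn ≤ x`,
`∑_{q ≤ Dn, (q,a)=1} ∑_{κ} |sievedDisc (PErr κ) q a z x| ≤ C Δ x (log x)^B`.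
[cite: BombieriFriedlanderIwaniecActa1986, §15 p. 245–246] -/
theorem sum_abs_sievedDisc_prodErr_le (hL3 : BombieriFriedlanderIwaniecLemma3) {a : ℤ} (ha : a ≠ 0) :
    ∃ B C x₀ : ℝ, 0 ≤ B ∧ 0 ≤ C ∧ ∀ x : ℝ, x₀ ≤ x → ∀ (z Δ : ℝ) (U j K Dn : ℕ),
      1 ≤ j → j ≤ 7 → 0 < Δ → Δ ≤ 1 → (Dn : ℝ) ≤ x →
      ∑ q ∈ (Icc 1 Dn).filter (fun q : ℕ => IsCoprime (q : ℤ) a),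
          ∑ κ ∈ tuples j K, |sievedDisc (fun n => prodErr x z Δ U j κ n) q a z x| ≤
        C * Δ * x * Real.log x ^ B := by
  obtain ⟨B, C, x₀, hB, hC, h⟩ := tau14_moments_le hL3 ha
  refine ⟨B, C, max x₀ (max (|(a : ℝ)|) 1), hB, hC,
    fun x hx z Δ U j K Dn hj hj7 hΔ hΔ1 hDn => ?_⟩
  have hx₀ : x₀ ≤ x := le_trans (le_max_left _ _) hx
  have hxa : |(a : ℝ)| ≤ x := le_trans ((le_max_left _ _).trans (le_max_right _ _)) hx
  have hx1 : (1 : ℝ) ≤ x := le_trans ((le_max_right _ _).trans (le_max_right _ _)) hx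
  have hx0 : 0 < x := by linarith
  have hG : ∀ n ∈ Ioc ⌊x⌋₊ ⌊2 * x⌋₊,
      ∑ κ ∈ tuples j K, |prodErr x z Δ U j κ n| ≤ Δ * (σ 0 n : ℝ) ^ 14 := by
    intro n hn
    rw [Finset.mem_Ioc] at hn
    refine (sum_abs_prodErr_le hj hx0 hΔ hΔ1 n).trans (mul_le_mul_of_nonneg_left ?_ hΔ.le)
    have h1 : (1 : ℝ) ≤ (σ 0 n : ℝ) := by exact_mod_cast one_le_sigma_zero (by omega)
    exact pow_le_pow_right₀ h1 (by omega)
  refine (sum_sum_abs_sievedDisc_le (tuples j K) (fun κ n => prodErr x z Δ U j κ n) hxa hG z Dn).trans ?_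
  have key := h x hx₀ Dn hDn
  have hΦ0 : 0 ≤ ∑ q ∈ Icc 1 Dn, ((Nat.totient q : ℝ))⁻¹ :=
    Finset.sum_nonneg fun _ _ => inv_nonneg.2 (Nat.cast_nonneg _)
  calc (∑ n ∈ Ioc ⌊x⌋₊ ⌊2 * x⌋₊, Δ * (σ 0 n : ℝ) ^ 14 * (σ 0 (Int.toNat ((n : ℤ) - a)) : ℝ)) +
        (∑ q ∈ Icc 1 Dn, ((Nat.totient q : ℝ))⁻¹) * ∑ n ∈ Ioc ⌊x⌋₊ ⌊2 * x⌋₊, Δ * (σ 0 n : ℝ) ^ 14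
      = Δ * ((∑ n ∈ Ioc ⌊x⌋₊ ⌊2 * x⌋₊, (σ 0 n : ℝ) ^ 14 * (σ 0 (Int.toNat ((n : ℤ) - a)) : ℝ)) +
        (∑ q ∈ Icc 1 Dn, ((Nat.totient q : ℝ))⁻¹) * ∑ n ∈ Ioc ⌊x⌋₊ ⌊2 * x⌋₊, (σ 0 n : ℝ) ^ 14) := by
        rw [Finset.mul_sum, Finset.mul_sum, mul_add, Finset.mul_sum, Finset.mul_sum]
        congr 1
        · exact Finset.sum_congr rfl fun n _ => by ring
        · exact Finset.sum_congr rfl fun n _ => by ring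
    _ ≤ Δ * (C * x * Real.log x ^ B) := mul_le_mul_of_nonneg_left key hΔ.le
    _ = C * Δ * x * Real.log x ^ B := by ring

/-! ### The non-interior main products -/

variable {x z Δ : ℝ} {U j K : ℕ}

/-- **Non-interior tuples, pointwise**: for `1 ≤ j ≤ 7`, `0 ≤ Δ` with `14Δ ≤ 1`, and `n ≥ 1`,
`∑_{κ not interior} |PMain κ (n)| ≤ τ(n)^{14} · 1[n ≤ x + 28Δx ∨ 2x − 28Δx < n]`
(`mem_slivers_of_not_interior` with `(1+Δ)^{14} ≤ 1 + 28Δ` and `2x(1+Δ)^{−14} ≥ 2x − 28Δx`).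
[cite: BombieriFriedlanderIwaniecActa1986, §15 p. 245–246] -/
theorem sum_abs_prodMain_not_interior_le (hj : 1 ≤ j) (hj7 : j ≤ 7) (hx : 0 < x) (hΔ : 0 ≤ Δ)
    (h14 : 14 * Δ ≤ 1) {n : ℕ} (hn : n ≠ 0) :
    ∑ κ ∈ (tuples j K).filter (fun κ => ¬ Interior x Δ j κ), |prodMain x z Δ U j κ n| ≤
      if (n : ℝ) ≤ x + 28 * Δ * x ∨ 2 * x - 28 * Δ * x < n then (σ 0 n : ℝ) ^ 14 else 0 := by
  split_ifs with h
  · calc ∑ κ ∈ (tuples j K).filter (fun κ => ¬ Interior x Δ j κ), |prodMain x z Δ U j κ n|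
        ≤ ∑ κ ∈ tuples j K, |prodMain x z Δ U j κ n| :=
          Finset.sum_le_sum_of_subset_of_nonneg (Finset.filter_subset _ _) fun _ _ _ => abs_nonneg _
      _ ≤ (σ 0 n : ℝ) ^ (2 * j) := sum_abs_prodMain_le hx hΔ n
      _ ≤ (σ 0 n : ℝ) ^ 14 := by
          have h1 : (1 : ℝ) ≤ (σ 0 n : ℝ) := by exact_mod_cast one_le_sigma_zero hn
          exact pow_le_pow_right₀ h1 (by omega)
  · refine (Finset.sum_eq_zero fun κ hκ => ?_).le
    rw [Finset.mem_filter] at hκ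
    rw [abs_eq_zero]
    by_contra hne
    have h1Δ : (1 : ℝ) ≤ 1 + Δ := by linarith
    have hpow : (1 + Δ) ^ (2 * j) ≤ (1 + Δ) ^ 14 := pow_le_pow_right₀ h1Δ (by omega)
    have hpow1 : (1 + Δ) ^ 14 ≤ 1 + 28 * Δ := by
      have := one_add_pow_le_one_add hΔ (m := 14) (by push_cast; linarith)
      push_cast at this; linarith
    rcases mem_slivers_of_not_interior hj hx hΔ hκ.2 hne with h1 | h1
    · refine h (Or.inl (h1.trans ?_))
      nlinarith
    · refine h (Or.inr (lt_of_le_of_lt ?_ h1))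
      calc 2 * x - 28 * Δ * x = 2 * x - (14 : ℕ) * Δ * (2 * x) := by push_cast; ring
        _ ≤ 2 * x / (1 + Δ) ^ 14 := sub_mul_le_div_one_add_pow hΔ (by linarith) 14
        _ ≤ 2 * x / (1 + Δ) ^ (2 * j) :=
            div_le_div_of_nonneg_left (by linarith) (by positivity) hpow

/-- `|sievedDisc F q a z x| ≤ ∑_{x<n≤2x, n≡a (q)} |F(n)| + φ(q)⁻¹ ∑_{x<n≤2x} |F(n)|` (drop the sieve
conditions). [folklore] -/
theorem abs_sievedDisc_le (F : ℕ → ℝ) (q : ℕ) (a : ℤ) (z x : ℝ) :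
    |sievedDisc F q a z x| ≤
      (∑ n ∈ (Ioc ⌊x⌋₊ ⌊2 * x⌋₊).filter (fun n : ℕ => (n : ZMod q) = (a : ZMod q)), |F n|) +
        ((Nat.totient q : ℝ))⁻¹ * ∑ n ∈ Ioc ⌊x⌋₊ ⌊2 * x⌋₊, |F n| := by
  unfold sievedDisc
  refine (abs_sub _ _).trans (add_le_add ?_ ?_)
  · rw [Finset.sum_filter]
    refine (Finset.abs_sum_le_sum_abs _ _).trans (Finset.sum_le_sum fun n _ => ?_)
    by_cases h : (n : ZMod q) = (a : ZMod q)
    · rw [if_pos h]; split_ifs <;> simp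
    · rw [if_neg h, if_neg (fun h' => h h'.2), abs_zero]
  · rw [abs_div, Nat.abs_cast, div_eq_inv_mul]
    refine mul_le_mul_of_nonneg_left ?_ (inv_nonneg.2 (Nat.cast_nonneg _))
    refine (Finset.abs_sum_le_sum_abs _ _).trans (Finset.sum_le_sum fun n _ => ?_)
    split_ifs <;> simp

/-- The same summed over a finite family with a pointwise majorant `∑_i |F i n| ≤ G n` on `(x,2x]`:
`∑_i |sievedDisc (F i) q| ≤ ∑_{x<n≤2x, n≡a (q)} G(n) + φ(q)⁻¹ ∑_{x<n≤2x} G(n)`. [folklore] -/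
theorem sum_abs_sievedDisc_le_of_majorant {ι : Type*} (s : Finset ι) (F : ι → ℕ → ℝ) {G : ℕ → ℝ}
    {x : ℝ} (hG : ∀ n ∈ Ioc ⌊x⌋₊ ⌊2 * x⌋₊, ∑ i ∈ s, |F i n| ≤ G n) (q : ℕ) (a : ℤ) (z : ℝ) :
    ∑ i ∈ s, |sievedDisc (F i) q a z x| ≤
      (∑ n ∈ (Ioc ⌊x⌋₊ ⌊2 * x⌋₊).filter (fun n : ℕ => (n : ZMod q) = (a : ZMod q)), G n) +
        ((Nat.totient q : ℝ))⁻¹ * ∑ n ∈ Ioc ⌊x⌋₊ ⌊2 * x⌋₊, G n := by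
  refine (Finset.sum_le_sum fun i _ => abs_sievedDisc_le (F i) q a z x).trans ?_
  rw [Finset.sum_add_distrib, ← Finset.mul_sum, Finset.sum_comm, Finset.sum_comm (s := s)]
  refine add_le_add (Finset.sum_le_sum fun n hn => hG n (Finset.mem_filter.1 hn).1)
    (mul_le_mul_of_nonneg_left (Finset.sum_le_sum fun n hn => hG n hn)
      (inv_nonneg.2 (Nat.cast_nonneg _)))


/-- A residue representative: for `q ≥ 1` and `(q, a) = 1` the natural number `(a mod q)` is
coprime to `q` and represents `a`. [folklore] -/
theorem exists_nat_rep_of_isCoprime {q : ℕ} (hq : 1 ≤ q) {a : ℤ} (ha : IsCoprime (q : ℤ) a) :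
    ∃ a' : ℕ, a'.Coprime q ∧ ((a' : ℕ) : ZMod q) = (a : ZMod q) := by
  haveI : NeZero q := ⟨by omega⟩
  refine ⟨(a : ZMod q).val, ?_, ZMod.natCast_zmod_val _⟩
  have hu : IsUnit ((a : ZMod q)) := (ZMod.coe_int_isUnit_iff_isCoprime a q).2 ha
  rw [← ZMod.natCast_zmod_val (a : ZMod q)] at hu
  exact (ZMod.isUnit_iff_coprime _ _).1 hu

/-- **The non-interior main products are negligible** (BFI §15, p. 245–246: the tuples of boxes
not inside `(x, 2x]` only meet the two slivers of relative length `O(Δ)` at the ends, where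
Shiu's theorem bounds the divisor moments in progressions): there are `B, C ≥ 0`, `x₀` such that
for `x ≥ x₀`, `1 ≤ j ≤ 7`, `x^{−1/5} ≤ Δ ≤ 1/28`, all `z, U, K` and `Dn ≤ x^{4/7}`,
`∑_{q ≤ Dn, (q,a)=1} ∑_{κ not interior} |sievedDisc (PMain κ) q a z x| ≤ C Δ x (log x)^B`.
[cite: BombieriFriedlanderIwaniecActa1986, §15 p. 245–246] -/
theorem sum_abs_sievedDisc_prodMain_not_interior_le (hS : Shiu1980BrunTitchmarsh) (a : ℤ) :
    ∃ B C x₀ : ℝ, 0 ≤ B ∧ 0 ≤ C ∧ ∀ x : ℝ, x₀ ≤ x → ∀ (z Δ : ℝ) (U j K Dn : ℕ),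
      1 ≤ j → j ≤ 7 → x ^ (-(1 / 5 : ℝ)) ≤ Δ → 28 * Δ ≤ 1 → (Dn : ℝ) ≤ x ^ (4 / 7 : ℝ) →
      ∑ q ∈ (Icc 1 Dn).filter (fun q : ℕ => IsCoprime (q : ℤ) a),
          ∑ κ ∈ (tuples j K).filter (fun κ => ¬ Interior x Δ j κ),
            |sievedDisc (fun n => prodMain x z Δ U j κ n) q a z x| ≤
        C * Δ * x * Real.log x ^ B := by
  obtain ⟨CS, x₀, hCS, hSh⟩ := hS.sigma_zero_pow 14 (ε := 1 / 4) (θ := 1 / 4)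
    (by norm_num) (by norm_num) (by norm_num) (by norm_num)
  obtain ⟨C₂, hC₂, h₂⟩ := exists_sum_sigma_zero_pow_div_totient_le_real 0
  obtain ⟨E, hE⟩ : ∃ E : ℕ, E = 2 ^ 14 - 1 := ⟨_, rfl⟩
  rw [← hE] at hSh
  refine ⟨((E + 4 : ℕ) : ℝ), 4 * 28 * 2 ^ E * CS * C₂, max x₀ 4, by positivity, by positivity,
    fun x hx z Δ U j K Dn hj hj7 hΔ hΔ1 hDn => ?_⟩
  have hx₀ : x₀ ≤ x := le_trans (le_max_left _ _) hx
  have hx4 : (4 : ℝ) ≤ x := le_trans (le_max_right _ _) hx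
  have hx0 : 0 < x := by linarith
  have hx1 : (1 : ℝ) ≤ x := by linarith
  have hL1 : 1 ≤ Real.log x := by
    rw [Real.le_log_iff_exp_le hx0]
    exact le_trans (by have := Real.exp_one_lt_d9; norm_num at this ⊢; linarith) hx4
  have hL0 : 0 < Real.log x := by linarith
  have hΔ0 : 0 < Δ := lt_of_lt_of_le (Real.rpow_pos_of_pos hx0 _) hΔ
  -- the sliver length
  set y : ℝ := 28 * Δ * x with hy
  have hyx : y ≤ x := by rw [hy]; nlinarith
  have hy0 : 0 < y := by positivity
  have hy45 : x ^ (4 / 5 : ℝ) ≤ y := by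
    have : x ^ (-(1 / 5 : ℝ)) * x ≤ Δ * x := mul_le_mul_of_nonneg_right hΔ hx0.le
    rw [← Real.rpow_add_one hx0.ne'] at this
    norm_num at this
    rw [hy]; nlinarith
  have hy14 : ∀ x' : ℝ, 0 ≤ x' → x' ≤ 2 * x → x' ^ (1 / 4 : ℝ) ≤ y := by
    intro x' hx'0 hx'2
    calc x' ^ (1 / 4 : ℝ) ≤ (2 * x) ^ (1 / 4 : ℝ) := Real.rpow_le_rpow hx'0 hx'2 (by norm_num)
      _ ≤ (x ^ (2 : ℝ)) ^ (1 / 4 : ℝ) := by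
          refine Real.rpow_le_rpow (by linarith) ?_ (by norm_num)
          rw [Real.rpow_two]; nlinarith
      _ = x ^ (1 / 2 : ℝ) := by rw [← Real.rpow_mul hx0.le]; norm_num
      _ ≤ x ^ (4 / 5 : ℝ) := Real.rpow_le_rpow_of_exponent_le hx1 (by norm_num)
      _ ≤ y := hy45
  have hyq : ∀ q : ℕ, q ∈ Icc 1 Dn → (q : ℝ) < y ^ (1 - 1 / 4 : ℝ) := by
    intro q hq
    rw [Finset.mem_Icc] at hq
    have hqD : (q : ℝ) ≤ Dn := by exact_mod_cast hq.2
    calc (q : ℝ) ≤ x ^ (4 / 7 : ℝ) := hqD.trans hDn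
      _ < x ^ (3 / 5 : ℝ) := Real.rpow_lt_rpow_of_exponent_lt (by linarith) (by norm_num)
      _ = (x ^ (4 / 5 : ℝ)) ^ (1 - 1 / 4 : ℝ) := by rw [← Real.rpow_mul hx0.le]; norm_num
      _ ≤ y ^ (1 - 1 / 4 : ℝ) := Real.rpow_le_rpow (Real.rpow_nonneg hx0.le _) hy45 (by norm_num)
  have hlog2x : Real.log (2 * x) ≤ 2 * Real.log x := by
    rw [Real.log_mul (by norm_num) hx0.ne']
    have : Real.log 2 ≤ Real.log x := Real.log_le_log (by norm_num) (by linarith)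
    linarith
  -- Shiu on the two slivers, for a modulus `q'` and a residue `c`
  have hShiu : ∀ q' : ℕ, 1 ≤ q' → (q' : ℝ) < y ^ (1 - 1 / 4 : ℝ) → ∀ c : ℕ, c.Coprime q' →
      ∑ n ∈ (Ioc ⌊x⌋₊ ⌊2 * x⌋₊).filter (fun n : ℕ => (n : ZMod q') = (c : ZMod q')),
          (if (n : ℝ) ≤ x + y ∨ 2 * x - y < n then (σ 0 n : ℝ) ^ 14 else 0) ≤
        2 * CS * y / (Nat.totient q' : ℝ) * (2 * Real.log x) ^ E := by
    intro q' hq' hq'y c hc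
    -- sliver 1: `(x, x + y]`
    have h1 := hSh x y hx₀ ((Real.rpow_le_rpow_of_exponent_le hx1 (by norm_num)).trans hy45) hyx
      q' hq' hq'y c hc
    -- sliver 2: `(2x − y, 2x]`
    have hx' : x ≤ 2 * x - y := by linarith
    have h2 := hSh (2 * x - y) y (hx₀.trans hx') (hy14 _ (by linarith) (by linarith))
      (hyx.trans hx') q' hq' hq'y c hc
    have h2' : 2 * x - y + y = 2 * x := by ring
    rw [h2'] at h2
    have hφ : (0 : ℝ) < (Nat.totient q' : ℝ) := by exact_mod_cast Nat.totient_pos.2 (by omega)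
    have hlogx' : Real.log (2 * x - y) ^ E ≤ (2 * Real.log x) ^ E :=
      pow_le_pow_left₀ (Real.log_nonneg (by linarith)) ((Real.log_le_log (by linarith)
        (by linarith)).trans hlog2x) E
    have hlogx1 : Real.log x ^ E ≤ (2 * Real.log x) ^ E := pow_le_pow_left₀ hL0.le (by linarith) E
    calc _ ≤ ∑ n ∈ (Ioc ⌊x⌋₊ ⌊2 * x⌋₊).filter (fun n : ℕ => (n : ZMod q') = (c : ZMod q')),
          ((if (n : ℝ) ≤ x + y then (σ 0 n : ℝ) ^ 14 else 0) +
            (if 2 * x - y < n then (σ 0 n : ℝ) ^ 14 else 0)) := by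
          refine Finset.sum_le_sum fun n _ => ?_
          by_cases ha1 : (n : ℝ) ≤ x + y <;> by_cases ha2 : 2 * x - y < n <;>
            simp [ha1, ha2]
      _ = (∑ n ∈ ((Ioc ⌊x⌋₊ ⌊2 * x⌋₊).filter (fun n : ℕ => (n : ZMod q') = (c : ZMod q'))).filter
              (fun n : ℕ => (n : ℝ) ≤ x + y), (σ 0 n : ℝ) ^ 14) +
          ∑ n ∈ ((Ioc ⌊x⌋₊ ⌊2 * x⌋₊).filter (fun n : ℕ => (n : ZMod q') = (c : ZMod q'))).filter
              (fun n : ℕ => 2 * x - y < n), (σ 0 n : ℝ) ^ 14 := by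
          rw [Finset.sum_add_distrib, Finset.sum_filter (p := fun n : ℕ => (n : ℝ) ≤ x + y),
            Finset.sum_filter (p := fun n : ℕ => 2 * x - y < n)]
      _ ≤ (∑ n ∈ (Icc 1 ⌊x + y⌋₊).filter (fun n : ℕ => x < n ∧ (n : ZMod q') = (c : ZMod q')),
              (σ 0 n : ℝ) ^ 14) +
          ∑ n ∈ (Icc 1 ⌊2 * x⌋₊).filter (fun n : ℕ => 2 * x - y < n ∧ (n : ZMod q') = (c : ZMod q')),
              (σ 0 n : ℝ) ^ 14 := by
          refine add_le_add (Finset.sum_le_sum_of_subset_of_nonneg (fun n hn => ?_)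
              fun _ _ _ => by positivity)
            (Finset.sum_le_sum_of_subset_of_nonneg (fun n hn => ?_) fun _ _ _ => by positivity)
          · simp only [Finset.mem_filter, Finset.mem_Ioc] at hn
            simp only [Finset.mem_filter, Finset.mem_Icc]
            refine ⟨⟨by omega, Nat.le_floor hn.2⟩, Nat.lt_of_floor_lt hn.1.1.1, hn.1.2⟩
          · simp only [Finset.mem_filter, Finset.mem_Ioc] at hn
            simp only [Finset.mem_filter, Finset.mem_Icc]
            exact ⟨⟨by omega, hn.1.1.2⟩, hn.2, hn.1.2⟩
      _ ≤ CS * y / (Nat.totient q' : ℝ) * Real.log x ^ E +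
          CS * y / (Nat.totient q' : ℝ) * Real.log (2 * x - y) ^ E := add_le_add h1 h2
      _ ≤ CS * y / (Nat.totient q' : ℝ) * (2 * Real.log x) ^ E +
          CS * y / (Nat.totient q' : ℝ) * (2 * Real.log x) ^ E :=
          add_le_add (mul_le_mul_of_nonneg_left hlogx1 (by positivity))
            (mul_le_mul_of_nonneg_left hlogx' (by positivity))
      _ = 2 * CS * y / (Nat.totient q' : ℝ) * (2 * Real.log x) ^ E := by ring
  -- the pointwise majorant
  have hG : ∀ n ∈ Ioc ⌊x⌋₊ ⌊2 * x⌋₊,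
      ∑ κ ∈ (tuples j K).filter (fun κ => ¬ Interior x Δ j κ), |prodMain x z Δ U j κ n| ≤
        (if (n : ℝ) ≤ x + y ∨ 2 * x - y < n then (σ 0 n : ℝ) ^ 14 else 0) := by
    intro n hn
    rw [Finset.mem_Ioc] at hn
    exact sum_abs_prodMain_not_interior_le hj hj7 hx0 hΔ0.le (by linarith) (by omega)
  -- per modulus
  have hq : ∀ q ∈ (Icc 1 Dn).filter (fun q : ℕ => IsCoprime (q : ℤ) a),
      ∑ κ ∈ (tuples j K).filter (fun κ => ¬ Interior x Δ j κ),
          |sievedDisc (fun n => prodMain x z Δ U j κ n) q a z x| ≤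
        4 * CS * y * (2 * Real.log x) ^ E * ((Nat.totient q : ℝ))⁻¹ := by
    intro q hq
    rw [Finset.mem_filter] at hq
    have hq1 : 1 ≤ q := (Finset.mem_Icc.1 hq.1).1
    obtain ⟨c, hc, hca⟩ := exists_nat_rep_of_isCoprime hq1 hq.2
    refine (sum_abs_sievedDisc_le_of_majorant _ (fun κ n => prodMain x z Δ U j κ n) hG q a z).trans ?_
    have hA := hShiu q hq1 (hyq q hq.1) c hc
    simp only [hca] at hA
    have hB := hShiu 1 le_rfl ((Nat.cast_le.2 hq1).trans_lt (hyq q hq.1)) 0 (Nat.coprime_one_right 0)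
    have hB' : ∑ n ∈ Ioc ⌊x⌋₊ ⌊2 * x⌋₊,
        (if (n : ℝ) ≤ x + y ∨ 2 * x - y < n then (σ 0 n : ℝ) ^ 14 else 0) ≤
        2 * CS * y * (2 * Real.log x) ^ E := by
      have hfil : (Ioc ⌊x⌋₊ ⌊2 * x⌋₊).filter (fun n : ℕ => (n : ZMod 1) = ((0 : ℕ) : ZMod 1)) =
          Ioc ⌊x⌋₊ ⌊2 * x⌋₊ := Finset.filter_true_of_mem fun n _ => Subsingleton.elim _ _
      rw [hfil, Nat.totient_one, Nat.cast_one, div_one] at hB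
      exact hB
    have hφ : (0 : ℝ) < (Nat.totient q : ℝ) := by exact_mod_cast Nat.totient_pos.2 (by omega)
    have hφ1 : (1 : ℝ) ≤ (Nat.totient q : ℝ) := by exact_mod_cast Nat.totient_pos.2 (by omega)
    calc _ ≤ 2 * CS * y / (Nat.totient q : ℝ) * (2 * Real.log x) ^ E +
          ((Nat.totient q : ℝ))⁻¹ * (2 * CS * y * (2 * Real.log x) ^ E) :=
          add_le_add hA (mul_le_mul_of_nonneg_left hB' (inv_nonneg.2 hφ.le))
      _ = 4 * CS * y * (2 * Real.log x) ^ E * ((Nat.totient q : ℝ))⁻¹ := by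
          field_simp; ring
  -- sum over the moduli
  have hΦ : ∑ q ∈ Icc 1 Dn, ((Nat.totient q : ℝ))⁻¹ ≤ C₂ * Real.log x ^ 4 := by
    have h := h₂ x (by linarith)
    simp only [pow_zero, one_div] at h
    norm_num at h
    have hDn' : Dn ≤ ⌊x⌋₊ := Nat.le_floor (hDn.trans (by
      calc x ^ (4 / 7 : ℝ) ≤ x ^ (1 : ℝ) := Real.rpow_le_rpow_of_exponent_le hx1 (by norm_num)
        _ = x := Real.rpow_one x))
    exact le_trans (Finset.sum_le_sum_of_subset_of_nonneg (Finset.Icc_subset_Icc le_rfl hDn')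
      fun _ _ _ => inv_nonneg.2 (Nat.cast_nonneg _)) h
  calc _ ≤ ∑ q ∈ (Icc 1 Dn).filter (fun q : ℕ => IsCoprime (q : ℤ) a),
        4 * CS * y * (2 * Real.log x) ^ E * ((Nat.totient q : ℝ))⁻¹ := Finset.sum_le_sum hq
    _ ≤ ∑ q ∈ Icc 1 Dn, 4 * CS * y * (2 * Real.log x) ^ E * ((Nat.totient q : ℝ))⁻¹ :=
        Finset.sum_le_sum_of_subset_of_nonneg (Finset.filter_subset _ _) fun _ _ _ => by positivity
    _ = 4 * CS * y * (2 * Real.log x) ^ E * ∑ q ∈ Icc 1 Dn, ((Nat.totient q : ℝ))⁻¹ := by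
        rw [Finset.mul_sum]
    _ ≤ 4 * CS * y * (2 * Real.log x) ^ E * (C₂ * Real.log x ^ 4) :=
        mul_le_mul_of_nonneg_left hΦ (by positivity)
    _ = (4 * 28 * 2 ^ E * CS * C₂) * Δ * x * (Real.log x ^ E * Real.log x ^ 4) := by
        rw [hy, mul_pow]; ring
    _ = (4 * 28 * 2 ^ E * CS * C₂) * Δ * x * Real.log x ^ ((E + 4 : ℕ) : ℝ) := by
        rw [← pow_add, Real.rpow_natCast]

end BFI

end Literature.NumberTheory.Sieve
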